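import Mathlib
import Summits.Ventures.HodgeRepro2.T5GammaFactor
import Summits.Ventures.HodgeRepro2.T6NAut
import Summits.Ventures.HodgeRepro2.T6N42Contract
import Summits.Ventures.HodgeRepro2.T6N42Toy
import Summits.Ventures.HodgeRepro2.T6N41Arch
import Summits.Ventures.HodgeRepro2.T6N41Main
import Summits.Ventures.HodgeRepro2.T6N41MainE
import Summits.Ventures.HodgeRepro2.T6N43Toy
import Summits.Ventures.HodgeRepro2.T6N43Lfac

/-!
# T6N42ToyNSide — a joint toy for the N4 side of the M2 carrier (README §10.5(ii)(c)/(d); owner t6-p5)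

The lead's `NSide` (T6NAut) bundles the three N4 owners' data — t6-p5's `FinitePlacesDatum` (N4.2),
t6-p6's `N43Places` (N4.3) and t6-p4's `DoublingLDatum` over all places (N4.1) — with the compat
field `theta_fin` (N4.1's `(H_loc)` at a finite place = N4.2's `ThetaNonzeroAt`) and the
by-construction identification of the archimedean `L`-factors (`NSide.ArchNonvanishing` through
`N43Places.withLfac`). This file exhibits ONE instance `toyNSide : NSide` built from the three
owners' accepted toys — `N42Toy.toyFinitePlaces`, `N43Places.toy`, and a doubling-`L` datum
`toyD41` whose local factors are `1` at the two finite places and the N4.3 toys' Eischen–Liu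
`Γ_ℂ`-products at the three real places, with `L = ∏_v L_v` — on which the binders of `N42_side`
(N4.2), of `N41_main` and `N41_mainE` (N4.1, with `A` = the three real places and `S` = all
places) and of `N43_places_withLfac` (N4.3) hold JOINTLY, and the three conclusions are obtained by applying the
three owners' theorems: `(H_loc)` at the finite places through the lead's `hloc_fin_iff`, `(R1)`,
and `Z^*_{τ′_j}(½) ≠ 0` at the three real places. As a non-vacuity datum must, it witnesses the
BINDERS (the carrier is inhabited and the displayed hypotheses are jointly satisfiable), not the
theorems.

The one analytic fact added on the way: an Eischen–Liu-shaped archimedean factor (a finite product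
of `Γ_ℂ(s + c_j)` with non-negative real shifts `c_j`) is HOLOMORPHIC at `s = 1`
(`analyticAt_one_of_eischenLiu`), which is what GQT Thm 11.4(ii)'s display asks of the global `L`
on the toy; its meromorphy and zero-freeness are t6-p4's `N41Core.archimedean_hyp_of_gammaC_shape`.

README §8(d): uses an L-value-free non-vanishing device: NO (TIER5 §N4, pre-02:16Z lines of
record, continued).
-/

namespace Summit.Ventures.HodgeRepro2.T6.N42ToyNSide

open Summit.Ventures.HodgeRepro2
open Summit.Ventures.HodgeRepro2.T6
open Summit.Ventures.HodgeRepro2.T6.N42Datum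
open Summit.Ventures.HodgeRepro2.T6.N42Toy

/-! ### A Γ_ℂ-product with non-negative shifts is holomorphic at `s = 1` -/

/-- `s ↦ Γ_ℂ(s + c)` is holomorphic at every `x` with `Re (x + c) > 0` (p1's
`T5GammaFactor.differentiableAt_GammaC` on an open neighbourhood). -/
theorem analyticAt_gammaC_shift (c x : ℂ) (h : 0 < (x + c).re) :
    AnalyticAt ℂ (fun s : ℂ => T5GammaFactor.GammaC (s + c)) x := by
  rw [Complex.analyticAt_iff_eventually_differentiableAt]
  have hopen : IsOpen {z : ℂ | 0 < (z + c).re} :=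
    isOpen_lt continuous_const (Complex.continuous_re.comp (continuous_id.add continuous_const))
  filter_upwards [hopen.mem_nhds h] with z hz
  exact (T5GammaFactor.differentiableAt_GammaC hz).comp z (differentiableAt_id.add_const c)

/-- A function of the Eischen–Liu shape `L s = (∏_j Γ_ℂ(s + c_j)) · ∏_j Γ_ℂ(s + d_j)` with
non-negative real shifts is holomorphic at `s = 1`. -/
theorem analyticAt_one_of_gammaC_shape {a b : ℕ} (c : Fin a → ℝ) (d : Fin b → ℝ)
    (hc : ∀ j, 0 ≤ c j) (hd : ∀ j, 0 ≤ d j) {L : ℂ → ℂ}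
    (hL : ∀ s : ℂ, L s = (∏ j, T5GammaFactor.GammaC (s + (c j : ℂ))) *
      ∏ j, T5GammaFactor.GammaC (s + (d j : ℂ))) :
    AnalyticAt ℂ L 1 := by
  have hfun : L = (∏ j, fun s : ℂ => T5GammaFactor.GammaC (s + (c j : ℂ))) *
      ∏ j, fun s : ℂ => T5GammaFactor.GammaC (s + (d j : ℂ)) := by
    funext s
    rw [hL s]
    simp [Finset.prod_apply]
  rw [hfun]
  refine (Finset.analyticAt_prod _ fun j _ => analyticAt_gammaC_shift _ 1 ?_).mul
    (Finset.analyticAt_prod _ fun j _ => analyticAt_gammaC_shift _ 1 ?_)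
  · simp only [Complex.add_re, Complex.one_re, Complex.ofReal_re]
    linarith [hc j]
  · simp only [Complex.add_re, Complex.one_re, Complex.ofReal_re]
    linarith [hd j]

/-- The archimedean factor displayed by t6-p6's `Hyp.EischenLiu2024_Sec2_2 a b τ ν r L` is
holomorphic at `s = 1`, for every weight `(τ; ν)` and twist `r` (the shifts are absolute values). -/
theorem analyticAt_one_of_eischenLiu {a b : ℕ} {τ : Fin a → ℤ} {ν : Fin b → ℤ} {r : ℤ} {L : ℂ → ℂ}
    (hEL : Hyp.EischenLiu2024_Sec2_2 a b τ ν r L) : AnalyticAt ℂ L 1 :=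
  analyticAt_one_of_gammaC_shape
    (fun j => |(τ j : ℝ) - (r : ℝ) / 2 + ((a : ℝ) - b + 1) / 2 - ((j : ℕ) + 1)|)
    (fun j => |(ν j : ℝ) - (r : ℝ) / 2 + ((a : ℝ) + b + 1) / 2 - ((j : ℕ) + 1)|)
    (fun _ => abs_nonneg _) (fun _ => abs_nonneg _) hEL

/-! ### The toy doubling-`L` datum over the toy's places -/

/-- The finite places of the toy N4.2 datum are inhabited finite types (`Unit`). -/
instance : Fintype toyFinitePlaces.SplitPlace := inferInstanceAs (Fintype Unit)

/-- The non-split places of the toy N4.2 datum (`Unit`). -/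
instance : Fintype toyFinitePlaces.NonsplitPlace := inferInstanceAs (Fintype Unit)

/-- The places of the toy: the two finite places of `toyFinitePlaces` and the three real places. -/
abbrev ToyPlace : Type := toyFinitePlaces.Place ⊕ Fin 3

/-- The archimedean local factors of the toy: the N4.3 toys' Eischen–Liu `Γ_ℂ`-products (the
compact place `τ′₁` = `toyU2`, signature `(2, 0)`; `τ′₂`, `τ′₃` = `toyU11`, signature `(1, 1)`;
weight `0`, twist `0`). -/
noncomputable def toyLvArch : Fin 3 → ℂ → ℂ
  | 0 => N43Toy.toyU2.Lfac
  | 1 => N43Toy.toyU11.Lfac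
  | 2 => N43Toy.toyU11.Lfac

/-- The local factors at all places: `1` at the finite places, `toyLvArch j` at the real place `j`. -/
noncomputable def toyLv : ToyPlace → ℂ → ℂ :=
  Sum.elim (fun _ _ => 1) toyLvArch

/-- The three real places, as the finite set `A` of `N41_main`'s archimedean binder. -/
noncomputable def toyA : Finset ToyPlace :=
  Finset.univ.map ⟨Sum.inr, Sum.inr_injective⟩

/-- A real place lies in `toyA`. -/
theorem inr_mem_toyA (j : Fin 3) : (Sum.inr j : ToyPlace) ∈ toyA :=
  Finset.mem_map_of_mem _ (Finset.mem_univ j)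

/-- A finite place does not lie in `toyA`. -/
theorem inl_notMem_toyA (w : toyFinitePlaces.Place) : (Sum.inl w : ToyPlace) ∉ toyA := by
  simp [toyA]

/-- The toy doubling-`L` datum of N4.1 over the toy's places: `S` = all places, the local factors
`toyLv`, `L = ∏_v L_v` (the finite product over the five places), `(H_loc)` true everywhere, the
auxiliary Hecke `L`-functions and their Euler factors `≡ 1`, both characters non-trivial. -/
noncomputable def toyD41 : DoublingLDatum ToyPlace where
  S := Finset.univ
  Lv := toyLv
  L := ∏ v, toyLv v
  thetaNonzero := fun _ => True
  L₁ := fun _ => 1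
  L₂ := fun _ => 1
  g₁ := fun _ _ => 1
  g₂ := fun _ _ => 1
  triv₁ := False
  triv₂ := False

/-- Every local factor of the toy is holomorphic at `s = 1`. -/
theorem analyticAt_toyLv_one (v : ToyPlace) : AnalyticAt ℂ (toyLv v) 1 := by
  rcases v with w | j
  · exact analyticAt_const
  · show AnalyticAt ℂ (toyLvArch j) 1
    fin_cases j
    · exact analyticAt_one_of_eischenLiu N43Toy.toyU2_EL
    · exact analyticAt_one_of_eischenLiu N43Toy.toyU11_EL
    · exact analyticAt_one_of_eischenLiu N43Toy.toyU11_EL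

/-- Every local factor of the toy is meromorphic on `ℂ` and zero-free at `s = 1` (t6-p4's
`archimedean_hyp_of_gammaC_shape` at the real places; a constant at the finite places). -/
theorem meromorphic_toyLv (v : ToyPlace) :
    MeromorphicOn (toyLv v) Set.univ ∧ meromorphicOrderAt (toyLv v) 1 ≤ 0 := by
  rcases v with w | j
  · refine ⟨analyticOnNhd_const.meromorphicOn, ?_⟩
    exact (T5OrderCounting.meromorphicOrderAt_eq_zero_of_ne_zero analyticAt_const one_ne_zero).le
  · show MeromorphicOn (toyLvArch j) Set.univ ∧ meromorphicOrderAt (toyLvArch j) 1 ≤ 0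
    fin_cases j
    · exact N41Core.archimedean_hyp_of_gammaC_shape _ _ N43Toy.toyU2_EL 1
    · exact N41Core.archimedean_hyp_of_gammaC_shape _ _ N43Toy.toyU11_EL 1
    · exact N41Core.archimedean_hyp_of_gammaC_shape _ _ N43Toy.toyU11_EL 1

/-! ### The N4.1 displays and the two composition inputs of `N41_main` on the toy -/

/-- GQT Thm 11.4(ii) on the toy: `L = ∏_v L_v` is holomorphic at `s = 1`. -/
theorem toyD41_GQT : Hyp.GQT2014_Thm11_4_ii toyD41 := fun _ =>
  show AnalyticAt ℂ (∏ v, toyLv v) 1 from Finset.analyticAt_prod _ fun v _ => analyticAt_toyLv_one v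

/-- Lapid–Rallis §10 (global) on the toy: `L(s) = ∏'_v L_v(s)` (a finite product) and `L` is
meromorphic on `ℂ`. -/
theorem toyD41_LR : Hyp.LapidRallis2005_Sec10_GlobalL toyD41 :=
  ⟨fun s _ => by simp [toyD41, Finset.prod_apply, tprod_fintype],
    N41Core.meromorphicOn_prod fun v _ => (meromorphic_toyLv v).1⟩

/-- Lapid–Rallis §10 (`p`-adic shape) on the toy, away from the real places: `L_v ≡ 1 = (1)⁻¹`. -/
theorem toyD41_padic : Hyp.LapidRallis2005_Sec10_padic toyD41 toyA := by
  intro v _ hvA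
  rcases v with w | j
  · exact ⟨1, 2, by norm_num, one_ne_zero, fun s => by simp [toyD41, toyLv]⟩
  · exact absurd (inr_mem_toyA j) hvA

/-- Iwasawa §3.1 on the toy (`a = 0`, `q = 2`, `L₁ = ∏' 1 = 1`). -/
theorem toyD41_euler₁ : Hyp.Iwasawa2019_Sec3_1_EulerProduct toyD41.L₁ toyD41.g₁ := by
  refine ⟨fun _ => 0, fun _ => 2, fun _ => by simp, fun _ => by norm_num,
    fun _ _ => by simp [toyD41], fun s _ => ⟨by simp [toyD41], by simp [toyD41]⟩⟩

/-- Iwasawa §3.1 on the toy for the second character. -/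
theorem toyD41_euler₂ : Hyp.Iwasawa2019_Sec3_1_EulerProduct toyD41.L₂ toyD41.g₂ := by
  refine ⟨fun _ => 0, fun _ => 2, fun _ => by simp, fun _ => by norm_num,
    fun _ _ => by simp [toyD41], fun s _ => ⟨by simp [toyD41], by simp [toyD41]⟩⟩

/-- Iwasawa Thm 3.1 on the toy (`L₁ ≡ 1` entire; `triv₁ = False`). -/
theorem toyD41_thm31₁ : Hyp.Iwasawa2019_Thm3_1 toyD41.L₁ toyD41.triv₁ :=
  ⟨fun _ _ => analyticAt_const.meromorphicAt, fun _ _ _ => analyticAt_const, fun h => h.elim⟩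

/-- Iwasawa Thm 3.1 on the toy for the second character. -/
theorem toyD41_thm31₂ : Hyp.Iwasawa2019_Thm3_1 toyD41.L₂ toyD41.triv₂ :=
  ⟨fun _ _ => analyticAt_const.meromorphicAt, fun _ _ _ => analyticAt_const, fun h => h.elim⟩

/-- Iwasawa Prop. 4.4 on the toy (`1 ≠ 0`). -/
theorem toyD41_prop44₁ : Hyp.Iwasawa2019_Prop4_4 toyD41.L₁ toyD41.triv₁ := fun _ _ => one_ne_zero

/-- Iwasawa Prop. 4.4 on the toy for the second character. -/
theorem toyD41_prop44₂ : Hyp.Iwasawa2019_Prop4_4 toyD41.L₂ toyD41.triv₂ := fun _ _ => one_ne_zero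

/-- The archimedean binder `harch` of `N41_main` on the toy, at the three real places. -/
theorem toyD41_harch : ∀ v ∈ toyA,
    MeromorphicOn (toyD41.Lv v) Set.univ ∧ meromorphicOrderAt (toyD41.Lv v) 1 ≤ 0 :=
  fun v _ => meromorphic_toyLv v

/-- The unramified binder `hunr` of `N41_main` is vacuous on the toy (`S` = all places). -/
theorem toyD41_hunr : ∀ v ∉ toyD41.S, ∀ s : ℂ, toyD41.Lv v s = toyD41.g₁ v s * toyD41.g₂ v s :=
  fun v hv => absurd (Finset.mem_univ v) hv

/-- `(H_loc)` on the toy. -/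
theorem toyD41_hloc : toyD41.Hloc := fun _ => trivial

/-- N4.1 applied to the toy: `(R1)` and both characters non-trivial. -/
theorem toyD41_N41 : toyD41.R1 ∧ toyD41.BothNontrivial :=
  N41Main.N41_main toyD41 toyA toyD41_GQT toyD41_LR toyD41_padic toyD41_euler₁ toyD41_euler₂
    toyD41_thm31₁ toyD41_thm31₂ toyD41_prop44₁ toyD41_prop44₂ toyD41_harch toyD41_hunr toyD41_hloc

/-- Iwasawa §3.1 in its faithful prime-indexed form (t6-p4's `EulerProductE`, the display
`N41_mainE` / `N4_main` consume) on the toy, with no primes at all (`κ = Empty`; empty products),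
as in t6-p4's `N41Toy.toy_eulerE₁`. -/
theorem toyD41_eulerE₁ : Hyp.Iwasawa2019_Sec3_1_EulerProductE toyD41.L₁ toyD41.g₁ := by
  refine ⟨Empty, fun e => e.elim, fun e => e.elim, fun e => e.elim, fun e => e.elim, fun e => e.elim,
    fun _ => Set.toFinite _, fun v s => ?_, fun s _ => ⟨summable_empty, ?_⟩⟩
  · have : IsEmpty {𝔓 : Empty // (fun e : Empty => e.elim) 𝔓 = v} := ⟨fun x => x.1.elim⟩
    simp [toyD41]
  · simp [toyD41]

/-- The same for the second character. -/
theorem toyD41_eulerE₂ : Hyp.Iwasawa2019_Sec3_1_EulerProductE toyD41.L₂ toyD41.g₂ := toyD41_eulerE₁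

/-- N4.1 in the form `N4_main` consumes (`N41_mainE`, the faithful Hecke display) applied to the
toy: every binder of `N41_mainE` holds jointly on `toyD41` with `A` = the three real places. -/
theorem toyD41_N41E : toyD41.R1 ∧ toyD41.BothNontrivial :=
  N41Main.N41_mainE toyD41 toyA toyD41_GQT toyD41_LR toyD41_padic toyD41_eulerE₁ toyD41_eulerE₂
    toyD41_thm31₁ toyD41_thm31₂ toyD41_prop44₁ toyD41_prop44₂ toyD41_harch toyD41_hunr toyD41_hloc

/-! ### The toy side -/

/-- The toy N4 side: t6-p5's `toyFinitePlaces`, t6-p6's `N43Places.toy`, the toy doubling-`L`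
datum `toyD41`; the compat field `theta_fin` holds because `(H_loc)` is true on `toyD41` and
`ThetaNonzeroAt` is true at every place of `toyFinitePlaces` (`N42_main` on the toy). -/
noncomputable def toyNSide : NSide where
  d42 := toyFinitePlaces
  d43 := N43Places.toy
  d41 := toyD41
  theta_fin := fun v =>
    ⟨fun _ => (toyFinitePlaces.thetaNonzeroEverywhere_iff.mp
      toyFinitePlaces_thetaNonzeroEverywhere) v, fun _ => trivial⟩

/-- (c) the carrier `NSide` is inhabited. -/
theorem nonempty_nSide : Nonempty NSide := ⟨toyNSide⟩

/-- N4.2 on the toy side through the contract wrapper: the six binders of `N42_side` hold on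
`toyNSide.d42` (the N4.2 toy's display instances) and give `(H_loc)` at the finite places in
N4.1's words, through the lead's `hloc_fin_iff` / `theta_fin`. -/
theorem toyNSide_hloc_fin : ∀ v : toyNSide.d42.Place, toyNSide.d41.thetaNonzero (Sum.inl v) :=
  N42Contract.N42_side_hloc_fin toyNSide
    ⟨fun _ => ⟨toyPair_irreducible, toyPair_smooth⟩,
      fun _ => ⟨trivial_irreducible, trivial_smooth⟩⟩
    (fun _ => Nat.zero_lt_succ 1) (fun _ => Nat.le_succ 2) (fun _ => toyTower_firstLift)
    (fun _ => toyTypeII_minguez) (fun _ => toyTower_ganIchino)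

/-- N4.3 on the toy side: the ten binders of `N43_places_withLfac` hold on `toyNSide.d43` with the
Eischen–Liu binders stated on `toyNSide.d41.Lv (Sum.inr j)` (= the N4.3 toys' own factors), and
give `NSide.ArchNonvanishing`. -/
theorem toyNSide_archNonvanishing : toyNSide.ArchNonvanishing :=
  N43Places.archNonvanishing_withLfac N43Places.toy _ N43Toy.toyU2_char N43Toy.toyU2_EL
    N43Toy.toyU11_fock N43Toy.toyU11_lowest N43Toy.toyU11_A2f N43Toy.toyU11_EL N43Toy.toyU11_fock
    N43Toy.toyU11_lowest N43Toy.toyU11_A2f N43Toy.toyU11_EL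

/-- `(H_loc)` on the toy side through the lead's `hloc_iff`: the finite half is N4.2 on the toy,
the archimedean half is the toy's `thetaNonzero`. -/
theorem toyNSide_hloc : toyNSide.d41.Hloc :=
  toyNSide.hloc_iff.mpr ⟨toyFinitePlaces_thetaNonzeroEverywhere, fun _ => trivial⟩

/-- README §10.5(ii)(d) for the N4 side of the M2 carrier: on `toyNSide` the binders of N4.2
(`N42_side`), N4.1 (`N41_main`) and N4.3 (`N43_places_withLfac`) are JOINTLY satisfied, and the
three owners' conclusions follow — `(R1) ∧ (H_loc)` in N4.1's words (`NSide.R1AndHloc`) and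
`Z^*_{τ′_j}(½) ≠ 0` at the three real places (`NSide.ArchNonvanishing`). -/
theorem toyNSide_N4 : toyNSide.R1AndHloc ∧ toyNSide.ArchNonvanishing :=
  ⟨⟨toyD41_N41.1, toyNSide_hloc⟩, toyNSide_archNonvanishing⟩

end Summit.Ventures.HodgeRepro2.T6.N42ToyNSide
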